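import Mathlib
import Literature.NumberTheory.LFunctions.Zhang2022.Section6HorizontalSides
import HarnessLib

/-!
# Zhang (2022), §6 (6.5), part 4/4: "moving the segment to `u = 0` and applying Lemma 5.1,
# `I″ ≪ E₁`" — REPAIRED (error at the reflected point `1 − s̄`) and PROVED

Topic `Literature/NumberTheory/LFunctions/Zhang2022` (Landau–Siegel audit tree; verdict-neutral).
Y. Zhang, *Discrete mean estimates and the Landau–Siegel zero*, arXiv:2211.02515v1 (2022)
[Zhang2022LandauSiegel] — **an unrefereed manuscript under adjudication**; nothing here asserts or
denies its Theorems 1–2 or anything about Landau–Siegel zeros, and nothing bears on the verdict on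
(8.24). Campaign DAG nodes `Z22:(6.5)` / `Z22:Lem6.1.pf` (§6 p. 32, tex L1755–L1781), typed in
`Section6Statements` as `Step6split` / `Step6last`; GAP-LEDGER rows G-d08-1 / G-d08-2.

> `I″ = (1/2πi)∫_{(−1)} (Z(s+w,ψ) − Z(s,ψ)(Pt₀)^{−w})(Σ_{n<T²} ψ̄(n)n^{−(1−s−w)}) P₄^w ω₁(w)dw/w`. (6.5)
> […] On the other hand, moving the segment `u = −1, |v| ≤ 𝓛²⁰` to `u = 0, |v| ≤ 𝓛²⁰` and applying
> Lemma 5.1, we find the right side of (6.5) is `≪ E₁(s,ψ)`. □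

This file (no new definitions, no facts):
* `conj_headSum_mul_I` — on `u = 0` the head sum is the `E₁`-sum at the REFLECTED point:
  `conj Σ_{n<T³} ψ̄(n)n^{−(1−s−iy)} = Σ_{n<T³} ψ(n)n^{−((1−s̄)+iy)}` (G-d08-2: `= E₁(s,ψ)`'s sum only
  on `σ = 1/2`);
* `norm_integrand65_line_le` — the integrand on `u = 0`, pointwise, by `norm_Zshift_div_le` (part 2);
* **`step6last_repaired`** — `‖I″‖ ≤ 2e¹⁶·(E1main x (1 − s̄) + e^{−𝓛¹⁰/8})` for `ψ ∈ Ψ`, `s` in the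
  range of Lemma 6.1, all `D ≥ ⌈e⁶⁰⌉` (`I″` = the segment/`T³` object of part 1): Cauchy–Goursat on
  the rectangle `[−1,0] × [−𝓛²⁰,𝓛²⁰]` (Mathlib
  `Complex.integral_boundary_rect_eq_zero_of_continuousOn_of_differentiableOn`; the singularity of
  `dw/w` at `w = 0` is removable since `Z(s+w) − Z(s)(Pt₀)^{−w}` vanishes there — `dslope`),
  horizontal sides by part 3, the side `u = 0` integrated against `|ω₁(iv)| = e^{−v²/4𝓛³⁰}`;
* `eq63_repaired_of_step6u015` — `Section6Statements.eq63_of_steps` re-threaded through the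
  repaired nodes: `Step6u015` (free claim) implies (6.3) with error `E1main x (1 − s̄) + ε`.
What is NOT asserted: `Step6u015`, (6.1)–(6.3), Lemma 6.1; the printed `Step6split`/`Step6last`.

## References

* Y. Zhang, arXiv:2211.02515v1 (2022), §6 p. 32, (6.3)–(6.5) and the last paragraph of the proof
  of Lemma 6.1; §5 Lemma 5.1; §4 (4.1) (`ω₁`). [cite: Zhang2022LandauSiegel, §6 (6.5)]
* H. L. Montgomery, R. C. Vaughan, *Multiplicative Number Theory I*, CUP 2007, Thm C.1 (Stirling),
  consumed through the tree's `GammaStirlingOrder` / `Section5VerticalShift`. [cite: montgomery2007, Thm C.1]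
-/

noncomputable section

open Complex Real Set MeasureTheory intervalIntegral

namespace Literature.NumberTheory.LFunctions.Zhang2022.Section6Statements

open Skeleton

variable {D : ℕ} (x : Chr D)

omit x in
/-- The closing arithmetic: `(1/2π)(9e¹⁶E + 2X) ≤ 2e¹⁶(E + X)`. [folklore] -/
private theorem aux_final {A E X : ℝ} (hE : 0 ≤ E) (hX : 0 ≤ X)
    (hA : A ≤ 9 * Real.exp 16 * E + 2 * X) : 1 / (2 * π) * A ≤ 2 * Real.exp 16 * (E + X) := by
  have hπ3 : 3 < π := Real.pi_gt_three
  have hE16 : 1 ≤ Real.exp 16 := Real.one_le_exp (by norm_num)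
  rw [div_mul_eq_mul_div, one_mul, div_le_iff₀ (by positivity)]
  have q1 : 9 * Real.exp 16 * E ≤ 2 * Real.exp 16 * E * (2 * π) := by
    have : (0 : ℝ) ≤ Real.exp 16 * E := by positivity
    nlinarith
  have hk : (2 : ℝ) ≤ 2 * Real.exp 16 * (2 * π) := by nlinarith
  have q2 : 2 * X ≤ 2 * Real.exp 16 * X * (2 * π) := by
    calc 2 * X = X * 2 := by ring
      _ ≤ X * (2 * Real.exp 16 * (2 * π)) := mul_le_mul_of_nonneg_left hk hX
      _ = 2 * Real.exp 16 * X * (2 * π) := by ring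
  linarith

/-- The head sum on `u = 0` is the `E₁`-sum at the reflected point: for real `y`,
`conj(Σ_{n<T³} ψ̄(n)n^{−(1−s−iy)}) = Σ_{n<T³} ψ(n)n^{−((1−s̄)+iy)}`.
[cite: Zhang2022LandauSiegel, §6 p.32, tex L1777; Lemma 6.1 (E₁) tex L1699] -/
theorem conj_headSum_mul_I (X : ℝ) (s : ℂ) (y : ℝ) :
    (starRingEnd ℂ) (headSum x X s (y * I)) =
      ∑ n ∈ Finset.Ico 1 ⌈X⌉₊, x.ψ (n : ZMod x.p) * (n : ℂ) ^ (-((1 - (starRingEnd ℂ) s) + y * I)) := by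
  simp only [headSum, psiBarFn, map_sum, map_mul, Complex.conj_conj]
  refine Finset.sum_congr rfl fun n _ => ?_
  congr 1
  have harg : ((n : ℂ)).arg ≠ π := by
    rw [Complex.natCast_arg]; exact Real.pi_ne_zero.symm
  have h := Complex.conj_cpow (n : ℂ) ((starRingEnd ℂ) (-(1 - s - y * I))) harg
  rw [Complex.conj_conj, Complex.conj_natCast] at h
  rw [← h]
  congr 1
  simp only [map_neg, map_sub, map_one, map_mul, Complex.conj_ofReal, Complex.conj_I]
  ring


/-- **The side `u = 0`, pointwise.** For `ψ ∈ Ψ`, `|σ − 1/2| ≤ 2α`, `|t − 2πt₀| < 𝓛₁ + 2`,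
`0 < |y| ≤ 𝓛²⁰` (`𝓛 ≥ 3`): the (repaired) (6.5) integrand at `w = iy` is bounded by
`9e¹⁶𝓛⁻⁶⁸ · |Σ_{n<T³} ψ(n)n^{−((1−s̄)+iy)}| · e^{−y²/4𝓛³⁰}` (Lemma 5.1 (5.2), `|P₄^{iy}| = 1`,
`|ω₁(iy)| = e^{−y²/4𝓛³⁰}`, and the head sum is the `E₁`-sum at the reflected point).
[cite: Zhang2022LandauSiegel, §6 p.32, tex L1777] -/
theorem norm_integrand65_line_le (hL : 3 ≤ ell D) {σ t y : ℝ} (hσ : |σ - 1 / 2| ≤ 2 * alpha D)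
    (ht : |t - 2 * π * ell D ^ 519| < ell D ^ 405 + 2) (hy0 : y ≠ 0) (hy : |y| ≤ ell D ^ 20) :
    ‖(GammaFactor.Zfac x.ψ (((σ : ℂ) + t * I) + (y : ℂ) * I) -
          GammaFactor.Zfac x.ψ ((σ : ℂ) + t * I) * ((bigP D * t0 D : ℝ) : ℂ) ^ (-((y : ℂ) * I))) *
        headSum x (bigT D ^ 3) ((σ : ℂ) + t * I) ((y : ℂ) * I) * kern D ((y : ℂ) * I)‖
      ≤ 9 * Real.exp 16 * (ell D ^ 68)⁻¹ *
        (‖∑ n ∈ Finset.Ico 1 ⌈bigT D ^ 3⌉₊, x.ψ (n : ZMod x.p) *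
            (n : ℂ) ^ (-((1 - (starRingEnd ℂ) ((σ : ℂ) + t * I)) + y * I))‖ *
          Real.exp (-(y ^ 2) / (4 * ell D ^ 30))) := by
  have hL1 : 1 ≤ ell D := by linarith
  have hD2' : 0 < ell D := by linarith
  have hP4 : 0 < P4 D := lt_of_lt_of_le one_pos (one_le_P4 hL)
  set Nv : ℂ := GammaFactor.Zfac x.ψ (((σ : ℂ) + t * I) + (y : ℂ) * I) -
    GammaFactor.Zfac x.ψ ((σ : ℂ) + t * I) * ((bigP D * t0 D : ℝ) : ℂ) ^ (-((y : ℂ) * I)) with hNv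
  have hNy : ‖Nv‖ / |y| ≤ 9 * Real.exp 16 * (ell D ^ 68)⁻¹ := by
    have h := norm_Zshift_div_le x hL hσ ht hy0 hy
    rwa [norm_div, norm_mul, Complex.norm_real, Complex.norm_I, mul_one, Real.norm_eq_abs] at h
  have hHy : ‖headSum x (bigT D ^ 3) ((σ : ℂ) + t * I) ((y : ℂ) * I)‖ =
      ‖∑ n ∈ Finset.Ico 1 ⌈bigT D ^ 3⌉₊, x.ψ (n : ZMod x.p) *
          (n : ℂ) ^ (-((1 - (starRingEnd ℂ) ((σ : ℂ) + t * I)) + y * I))‖ := by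
    rw [← Complex.norm_conj, conj_headSum_mul_I]
  have hKy : ‖kern D ((y : ℂ) * I)‖ = Real.exp (-(y ^ 2) / (4 * ell D ^ 30)) / |y| := by
    simp only [kern]
    rw [norm_div, norm_mul, Complex.norm_cpow_eq_rpow_re_of_pos hP4]
    have h1 : ((y : ℂ) * I).re = 0 := by simp
    rw [h1, Real.rpow_zero, one_mul]
    have h2 : ‖GaussWeight.omega1 (ell D ^ 30) ((y : ℂ) * I)‖ =
        Real.exp (-(y ^ 2) / (4 * ell D ^ 30)) := by
      have := GaussWeight.norm_omega1 (ell D ^ 30) 0 y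
      simp only [Complex.ofReal_zero, zero_add] at this
      rw [this]; congr 1; ring
    rw [h2, norm_mul, Complex.norm_real, Complex.norm_I, mul_one, Real.norm_eq_abs]
  have hypos : 0 < |y| := abs_pos.mpr hy0
  rw [norm_mul, norm_mul, hHy, hKy]
  set Sy : ℝ := ‖∑ n ∈ Finset.Ico 1 ⌈bigT D ^ 3⌉₊, x.ψ (n : ZMod x.p) *
      (n : ℂ) ^ (-((1 - (starRingEnd ℂ) ((σ : ℂ) + t * I)) + y * I))‖ with hSy
  have hSy0 : 0 ≤ Sy := norm_nonneg _
  have hE0 : 0 ≤ Real.exp (-(y ^ 2) / (4 * ell D ^ 30)) := (Real.exp_pos _).le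
  calc ‖Nv‖ * Sy * (Real.exp (-(y ^ 2) / (4 * ell D ^ 30)) / |y|)
      = ‖Nv‖ / |y| * (Sy * Real.exp (-(y ^ 2) / (4 * ell D ^ 30))) := by
        field_simp
    _ ≤ 9 * Real.exp 16 * (ell D ^ 68)⁻¹ * (Sy * Real.exp (-(y ^ 2) / (4 * ell D ^ 30))) :=
        mul_le_mul_of_nonneg_right hNy (mul_nonneg hSy0 hE0)

/-- **`Z22:Lem6.1.pf`, last sentence (tex L1777), REPAIRED (GAP-LEDGER G-d08-2) and PROVED**:
"moving the segment `u = −1, |v| ≤ 𝓛²⁰` to `u = 0, |v| ≤ 𝓛²⁰` and applying Lemma 5.1, the right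
side of (6.5) is `≪ E₁`" — with `I″` the segment/`T³` object of G-d08-1 (part 1) and the error at the
REFLECTED point `1 − s̄` (`= s` exactly on `σ = 1/2`): for `ψ ∈ Ψ`, `|σ − 1/2| < 2α`,
`|t − 2πt₀| < 𝓛₁ + 2`, `D ≥ ⌈e⁶⁰⌉`: `‖I″‖ ≤ 2e¹⁶·(E1main x (1 − s̄) + exp(−𝓛¹⁰/8))`. Cauchy–Goursat
on `[−1,0] × [−𝓛²⁰,𝓛²⁰]` for `w ↦ dslope(Z(s+·) − Z(s)(Pt₀)^{−·}, 0)(w)·(Σ_{n<T³}…)·P₄^w ω₁(w)`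
(`=` the integrand for `w ≠ 0`); horizontal sides by part 3; on `u = 0`, `norm_integrand65_line_le`
integrates to `9e¹⁶𝓛⁻⁶⁸ · 𝓛⁶⁸ E1main x (1 − s̄)`. The (A) antecedent is not used.
[cite: Zhang2022LandauSiegel, §6 p.32, tex L1777] -/
theorem step6last_repaired : ∃ c : ℝ, 0 < c ∧ ∃ C : ℝ, ForAllLarge fun D _ χ => AssumptionA D χ →
    ∀ x : Chr D, ∀ s : ℂ, InRange61 D s →
      ‖vseg (fun w => (GammaFactor.Zfac x.ψ (s + w) -
            GammaFactor.Zfac x.ψ s * ((bigP D * t0 D : ℝ) : ℂ) ^ (-w)) *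
          headSum x (bigT D ^ 3) s w * kern D w) (-1) (ell D ^ 20)‖
        ≤ C * (E1main x (1 - (starRingEnd ℂ) s) + Real.exp (-c * ell D ^ 10)) := by
  refine ⟨1 / 8, by norm_num, 2 * Real.exp 16, ⌈Real.exp 60⌉₊, fun D _ χ hD _ _ _ x s hs => ?_⟩
  have hL60 : 60 ≤ ell D := sixty_le_ell_of_le hD
  have hL3 : 3 ≤ ell D := by linarith
  have hL1 : 1 ≤ ell D := by linarith
  have hL0 : 0 < ell D := by linarith
  obtain ⟨σ, t, rfl⟩ : ∃ σ' t' : ℝ, s = σ' + t' * I := ⟨s.re, s.im, (re_add_im s).symm⟩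
  obtain ⟨hσ, ht⟩ := hs
  have hσ' : |σ - 1 / 2| < 2 * alpha D := by simpa using hσ
  have ht' : |t - 2 * π * t0 D| < ell1 D + 2 := by simpa using ht
  rw [ell1, t0] at ht'
  have hα : alpha D = π / ell D ^ 9 := by rw [alpha, bigP, Real.log_exp]
  have hσ4 : |σ - 1 / 2| ≤ 1 / 4 := hσ'.le.trans (by rw [hα]; exact two_alpha_le hL3)
  obtain ⟨hσa, hσb⟩ := abs_le.mp hσ4
  obtain ⟨ht5, ht8⟩ := t_range hL3 ht'
  have hV1 : (1 : ℝ) ≤ ell D ^ 20 := one_le_pow₀ hL1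
  have hP0 : 0 < bigP D := Real.exp_pos _
  have ht00 : 0 < t0 D := pow_pos hL0 519
  have hR0 : 0 < bigP D * t0 D := mul_pos hP0 ht00
  have hP4 : 0 < P4 D := lt_of_lt_of_le one_pos (one_le_P4 hL3)
  set V : ℝ := ell D ^ 20 with hV
  set sC : ℂ := (σ : ℂ) + t * I with hsC
  set N : ℂ → ℂ := fun w => GammaFactor.Zfac x.ψ (sC + w) -
    GammaFactor.Zfac x.ψ sC * ((bigP D * t0 D : ℝ) : ℂ) ^ (-w) with hN
  set H : ℂ → ℂ := fun w => headSum x (bigT D ^ 3) sC w with hH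
  set G : ℂ → ℂ := fun w => N w * H w * kern D w with hG
  set Ft : ℂ → ℂ := fun w => dslope N 0 w *
    (H w * (((P4 D : ℝ) : ℂ) ^ w * GaussWeight.omega1 (ell D ^ 30) w)) with hFt
  have hN0 : N 0 = 0 := by simp [hN]
  have hFtG : ∀ w : ℂ, w ≠ 0 → Ft w = G w := by
    intro w hw
    simp only [hFt, hG, kern]
    rw [dslope_of_ne _ hw, slope_def_field, hN0, sub_zero, sub_zero]
    ring
  have htC : |sC.im - 2 * π * ell D ^ 519| < ell D ^ 405 + 2 := by simpa [hsC] using ht'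
  have himR : ∀ w : ℂ, |w.im| ≤ V → 0 < (sC + w).im := fun w hw => im_pos_of_range hL3 htC hw
  have hN_diff : ∀ w : ℂ, |w.im| ≤ V → DifferentiableAt ℂ N w :=
    fun w hw => differentiableAt_Zshift x sC hR0 (himR w hw)
  have hHQ_diff : ∀ w : ℂ, DifferentiableAt ℂ
      (fun w => H w * (((P4 D : ℝ) : ℂ) ^ w * GaussWeight.omega1 (ell D ^ 30) w)) w := by
    intro w
    have h1 : DifferentiableAt ℂ (fun w : ℂ => ((P4 D : ℝ) : ℂ) ^ w) w :=
      differentiableAt_id.const_cpow (Or.inl (by exact_mod_cast hP4.ne'))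
    have h2 : DifferentiableAt ℂ (GaussWeight.omega1 (ell D ^ 30)) w := by
      unfold GaussWeight.omega1; fun_prop
    exact (differentiableAt_headSum x _ sC w).mul (h1.mul h2)
  have hFt_cont : ∀ w : ℂ, |w.im| ≤ V → ContinuousAt Ft w := by
    intro w hw
    by_cases h0 : w = 0
    · subst h0
      exact (continuousAt_dslope_same.mpr (hN_diff 0 hw)).mul (hHQ_diff 0).continuousAt
    · exact ((continuousAt_dslope_of_ne h0).mpr (hN_diff w hw).continuousAt).mul
        (hHQ_diff w).continuousAt
  have hFt_diff : ∀ w : ℂ, w ≠ 0 → |w.im| ≤ V → DifferentiableAt ℂ Ft w := by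
    intro w h0 hw
    exact ((differentiableAt_dslope_of_ne h0).mpr (hN_diff w hw)).mul (hHQ_diff w)
  -- Cauchy–Goursat on the rectangle `[−1,0] × [−V,V]`
  have hV0 : 0 ≤ V := by positivity
  have Hc : ContinuousOn Ft (Set.uIcc (-1 : ℝ) 0 ×ℂ Set.uIcc (-V) V) := by
    intro w hw
    obtain ⟨-, him⟩ := hw
    rw [Set.uIcc_of_le (by linarith : -V ≤ V)] at him
    exact (hFt_cont w (abs_le.mpr ⟨him.1, him.2⟩)).continuousWithinAt
  have Hd : DifferentiableOn ℂ Ft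
      (Set.Ioo (min (-1 : ℝ) 0) (max (-1 : ℝ) 0) ×ℂ Set.Ioo (min (-V) V) (max (-V) V)) := by
    intro w hw
    obtain ⟨hre, him⟩ := hw
    rw [min_eq_left (by norm_num), max_eq_right (by norm_num)] at hre
    rw [min_eq_left (by linarith), max_eq_right (by linarith)] at him
    have h0 : w ≠ 0 := by
      intro h; rw [h] at hre; simp at hre
    exact (hFt_diff w h0 (abs_le.mpr ⟨him.1.le, him.2.le⟩)).differentiableWithinAt
  have key := Complex.integral_boundary_rect_eq_zero_of_continuousOn_of_differentiableOn Ft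
    ⟨-1, -V⟩ ⟨0, V⟩ Hc Hd
  have key' : (∫ u in (-1 : ℝ)..0, Ft (u + (-V : ℝ) * I)) - (∫ u in (-1 : ℝ)..0, Ft (u + (V : ℝ) * I))
      + I • (∫ y in (-V)..V, Ft ((0 : ℝ) + y * I)) - I • (∫ y in (-V)..V, Ft ((-1 : ℝ) + y * I)) = 0 :=
    key
  have hne1 : ∀ v : ℝ, ((-1 : ℝ) : ℂ) + (v : ℂ) * I ≠ 0 := by
    intro v h; have := congrArg Complex.re h; simp at this
  have hGF : (∫ v in (-V)..V, G (((-1 : ℝ) : ℂ) + (v : ℂ) * I)) =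
      ∫ v in (-V)..V, Ft (((-1 : ℝ) : ℂ) + (v : ℂ) * I) :=
    intervalIntegral.integral_congr fun v _ => (hFtG _ (hne1 v)).symm
  set a := ∫ y in (-V)..V, Ft (((-1 : ℝ) : ℂ) + (y : ℂ) * I) with ha
  set e := ∫ y in (-V)..V, Ft (((0 : ℝ) : ℂ) + (y : ℂ) * I) with he
  set bot := ∫ u in (-1 : ℝ)..0, Ft ((u : ℂ) + ((-V : ℝ) : ℂ) * I) with hbot
  set top := ∫ u in (-1 : ℝ)..0, Ft ((u : ℂ) + ((V : ℝ) : ℂ) * I) with htop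
  have hnorm : ‖a‖ ≤ ‖e‖ + ‖bot‖ + ‖top‖ := by
    have h1 : I • a = bot - top + I • e := by
      have h := key'
      rw [sub_eq_zero] at h
      exact h.symm
    have h2 : ‖I • a‖ = ‖a‖ := by rw [norm_smul, Complex.norm_I, one_mul]
    have h3 : ‖I • e‖ = ‖e‖ := by rw [norm_smul, Complex.norm_I, one_mul]
    rw [← h2, h1]
    calc ‖bot - top + I • e‖ ≤ ‖bot - top‖ + ‖I • e‖ := norm_add_le _ _
      _ ≤ ‖bot‖ + ‖top‖ + ‖e‖ := by rw [h3]; linarith [norm_sub_le bot top]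
      _ = ‖e‖ + ‖bot‖ + ‖top‖ := by ring
  set S : ℝ → ℂ := fun y => ∑ n ∈ Finset.Ico 1 ⌈bigT D ^ 3⌉₊,
    x.ψ (n : ZMod x.p) * (n : ℂ) ^ (-((1 - (starRingEnd ℂ) sC) + y * I)) with hS
  set B₀ : ℝ := 9 * Real.exp 16 * (ell D ^ 68)⁻¹ with hB₀
  have he_pt : ∀ y : ℝ, y ≠ 0 → y ∈ Set.Ioc (-V) V →
      ‖Ft (((0 : ℝ) : ℂ) + (y : ℂ) * I)‖ ≤ B₀ * (‖S y‖ * Real.exp (-(y ^ 2) / (4 * ell D ^ 30))) := by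
    intro y hy0 hy
    have hyV : |y| ≤ V := abs_le.mpr ⟨hy.1.le, hy.2⟩
    have hyI : ((0 : ℝ) : ℂ) + (y : ℂ) * I = (y : ℂ) * I := by push_cast; ring
    have hyI0 : (y : ℂ) * I ≠ 0 := by
      intro h; have := congrArg Complex.im h; simp at this; exact hy0 this
    rw [hyI, hFtG _ hyI0]
    exact norm_integrand65_line_le x hL3 hσ'.le ht' hy0 hyV
  have hS_cont : Continuous S := by
    simp only [hS]
    refine continuous_finsetSum _ fun n hn => ?_
    have hn0 : (n : ℂ) ≠ 0 := by
      have : 1 ≤ n := (Finset.mem_Ico.mp hn).1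
      exact_mod_cast (by omega : n ≠ 0)
    have : Continuous fun y : ℝ => -((1 - (starRingEnd ℂ) sC) + (y : ℂ) * I) := by fun_prop
    exact continuous_const.mul (this.const_cpow (Or.inl hn0))
  have hg_int : IntervalIntegrable
      (fun y : ℝ => B₀ * (‖S y‖ * Real.exp (-(y ^ 2) / (4 * ell D ^ 30)))) volume (-V) V := by
    refine Continuous.intervalIntegrable ?_ _ _
    exact continuous_const.mul (hS_cont.norm.mul (by fun_prop))
  have he_bound : ‖e‖ ≤ B₀ * (ell D ^ 68 * E1main x (1 - (starRingEnd ℂ) sC)) := by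
    have hae : ∀ᵐ y : ℝ, y ∈ Set.Ioc (-V) V →
        ‖Ft (((0 : ℝ) : ℂ) + (y : ℂ) * I)‖ ≤ B₀ * (‖S y‖ * Real.exp (-(y ^ 2) / (4 * ell D ^ 30))) := by
      filter_upwards [MeasureTheory.Measure.ae_ne volume (0 : ℝ)] with y hy0 hy
      exact he_pt y hy0 hy
    have h1 := intervalIntegral.norm_integral_le_of_norm_le (by linarith : -V ≤ V) hae hg_int
    rw [intervalIntegral.integral_const_mul] at h1
    refine h1.trans (le_of_eq ?_)
    congr 1
    have hE : E1main x (1 - (starRingEnd ℂ) sC) = (ell D ^ 68)⁻¹ *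
        ∫ v in (-V)..V, ‖S v‖ * Real.exp (-(v ^ 2) / (4 * ell D ^ 30)) := by
      simp only [E1main, hS, hV]
    rw [hE, ← mul_assoc, mul_inv_cancel₀ (by positivity), one_mul]
  set Kh : ℝ := (64 * π ^ 2 * (x.p : ℝ) ^ 2 * (10 * ell D ^ 519) ^ 2 +
      Real.exp 16 * (Real.exp (ell D ^ 9) * ell D ^ 519)) *
    (Real.exp (ell D ^ (1.1 : ℝ)) ^ 3 + 1) * Real.exp ((1 - (ell D ^ 20) ^ 2) / (4 * ell D ^ 30)) with hKh
  have hp0 : (0 : ℝ) ≤ x.p := Nat.cast_nonneg _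
  have hp2P : (x.p : ℝ) ≤ 2 * Real.exp (ell D ^ 9) := by
    have hm := x.mem
    rw [primeWindow, Finset.mem_filter, Finset.mem_Ioo] at hm
    have hpP : (x.p : ℝ) < bigP D * (1 + (ell D ^ 68)⁻¹) := Nat.lt_ceil.mp hm.1.2
    have h68 : (ell D ^ 68)⁻¹ ≤ 1 := inv_le_one_of_one_le₀ (one_le_pow₀ hL1)
    have : bigP D * (1 + (ell D ^ 68)⁻¹) ≤ 2 * Real.exp (ell D ^ 9) := by
      rw [bigP]; nlinarith [Real.exp_pos (ell D ^ 9)]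
    linarith
  have hKh_small : Kh ≤ Real.exp (-(1 / 8) * ell D ^ 10) := horiz_le_exp hL60 hp0 hp2P
  have hZs : ‖GammaFactor.Zfac x.ψ sC‖ ≤ Real.exp 16 := norm_Zfac_le_exp_sixteen x hL3 hσ'.le ht'
  have h_side : ∀ Vs : ℝ, |Vs| = V → ∀ u ∈ Set.uIoc (-1 : ℝ) 0,
      ‖Ft ((u : ℂ) + ((Vs : ℝ) : ℂ) * I)‖ ≤ Kh := by
    intro Vs hVs u hu
    rw [Set.uIoc_of_le (by norm_num)] at hu
    obtain ⟨hu1, hu0⟩ := hu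
    have hVs0 : Vs ≠ 0 := by
      intro h; rw [h, abs_zero] at hVs; linarith
    have hw0 : (u : ℂ) + ((Vs : ℝ) : ℂ) * I ≠ 0 := by
      intro h; have := congrArg Complex.im h; simp at this; exact hVs0 this
    rw [hFtG _ hw0]
    exact norm_integrand65_horiz_le x hL3 (by linarith) (by linarith) ht5 ht8 hu1 hu0 hVs hZs
  have h01 : |(0 : ℝ) - (-1)| = 1 := by norm_num
  have hbot : ‖bot‖ ≤ Kh := by
    have h := intervalIntegral.norm_integral_le_of_norm_le_const
      (h_side (-V) (by rw [abs_neg, abs_of_nonneg hV0]))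
    rw [h01, mul_one] at h
    exact h
  have htop : ‖top‖ ≤ Kh := by
    have h := intervalIntegral.norm_integral_le_of_norm_le_const
      (h_side V (abs_of_nonneg hV0))
    rw [h01, mul_one] at h
    exact h
  show ‖vseg G (-1) V‖ ≤ 2 * Real.exp 16 *
    (E1main x (1 - (starRingEnd ℂ) sC) + Real.exp (-(1 / 8) * ell D ^ 10))
  have hvs : vseg G (-1) V = (1 / (2 * π) : ℂ) * a := by
    rw [← hGF]; rfl
  rw [hvs, norm_mul]
  have hc : ‖(1 / (2 * π) : ℂ)‖ = 1 / (2 * π) := by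
    rw [norm_div, norm_one, norm_mul, Complex.norm_ofNat, Complex.norm_real,
      Real.norm_of_nonneg Real.pi_pos.le]
  rw [hc]
  have hE0 : 0 ≤ E1main x (1 - (starRingEnd ℂ) sC) := E1main_nonneg x _
  have hB68 : B₀ * (ell D ^ 68 * E1main x (1 - (starRingEnd ℂ) sC)) =
      9 * Real.exp 16 * E1main x (1 - (starRingEnd ℂ) sC) := by
    rw [hB₀]; field_simp
  have h1 : ‖a‖ ≤ 9 * Real.exp 16 * E1main x (1 - (starRingEnd ℂ) sC) +
      2 * Real.exp (-(1 / 8) * ell D ^ 10) :=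
    calc ‖a‖ ≤ ‖e‖ + ‖bot‖ + ‖top‖ := hnorm
      _ ≤ B₀ * (ell D ^ 68 * E1main x (1 - (starRingEnd ℂ) sC)) + Kh + Kh :=
          add_le_add (add_le_add he_bound hbot) htop
      _ = 9 * Real.exp 16 * E1main x (1 - (starRingEnd ℂ) sC) + 2 * Kh := by rw [hB68]; ring
      _ ≤ 9 * Real.exp 16 * E1main x (1 - (starRingEnd ℂ) sC) +
          2 * Real.exp (-(1 / 8) * ell D ^ 10) := by linarith
  exact aux_final hE0 (Real.exp_pos _).le h1

/-! ## The re-threaded (6.3) edge -/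

/-- **`Z22:Lem6.1.pf` EDGE, re-threaded through the repaired nodes.** From the free claim
`Step6u015` ("`I′ = −Z(s,ψ)N(1−s,ψ̄) + O(ε)`") and the two theorems `step6split_repaired`,
`step6last_repaired`, (6.3) follows with the error term at the reflected point:
`‖LHS(6.3) + Z(s,ψ)N(1−s,ψ̄)‖ ≤ C·(E1main x (1 − s̄) + e^{−c𝓛¹⁰})` — the kernel counterpart of
`Section6Statements.eq63_of_steps` (which consumes the printed `Step6split`/`Step6last`).
[cite: Zhang2022LandauSiegel, §6 (6.3)–(6.5) p.32, tex L1755–1778] -/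
theorem eq63_repaired_of_step6u015 (hI : Step6u015) :
    ∃ c : ℝ, 0 < c ∧ ∃ C : ℝ, ForAllLarge fun D _ χ => AssumptionA D χ → ∀ x : Chr D, ∀ s : ℂ,
      InRange61 D s →
        ‖lhs63 x s + GammaFactor.Zfac x.ψ s * Nchar D (psiBarFn x) (1 - s)‖
          ≤ C * (E1main x (1 - (starRingEnd ℂ) s) + Real.exp (-c * ell D ^ 10)) := by
  obtain ⟨c₁, hc₁, C₁, h₁⟩ := hI
  obtain ⟨c₂, hc₂, C₂, h₂⟩ := step6last_repaired
  refine ⟨min c₁ c₂, lt_min hc₁ hc₂, max C₁ 0 + max C₂ 0, ?_⟩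
  obtain ⟨D₀, h⟩ := (step6split_repaired.and h₁).and h₂
  refine ⟨D₀, fun D _ χ hD hq hp hA x s hr => ?_⟩
  obtain ⟨⟨hS', hI'⟩, hII'⟩ := h D χ hD hq hp
  have e0 := hS' hA x s hr
  have e1 := hI' hA x s hr
  have e2 := hII' hA x s hr
  set I2 := vseg (fun w => (GammaFactor.Zfac x.ψ (s + w) -
      GammaFactor.Zfac x.ψ s * ((bigP D * t0 D : ℝ) : ℂ) ^ (-w)) *
    headSum x (bigT D ^ 3) s w * kern D w) (-1) (ell D ^ 20) with hI2
  set E : ℝ := E1main x (1 - (starRingEnd ℂ) s) with hE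
  have hE0 : 0 ≤ E := E1main_nonneg x _
  have key : lhs63 x s + GammaFactor.Zfac x.ψ s * Nchar D (psiBarFn x) (1 - s) =
      (Iprime x s + GammaFactor.Zfac x.ψ s * Nchar D (psiBarFn x) (1 - s)) + I2 := by
    rw [e0]; ring
  rw [key]
  have hℓ : 0 ≤ ell D ^ 10 := pow_nonneg (Real.log_natCast_nonneg D) _
  have hε₁ : Real.exp (-c₁ * ell D ^ 10) ≤ Real.exp (-(min c₁ c₂) * ell D ^ 10) :=
    Real.exp_le_exp.mpr (by nlinarith [min_le_left c₁ c₂])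
  have hε₂ : Real.exp (-c₂ * ell D ^ 10) ≤ Real.exp (-(min c₁ c₂) * ell D ^ 10) :=
    Real.exp_le_exp.mpr (by nlinarith [min_le_right c₁ c₂])
  have i1 : ‖Iprime x s + GammaFactor.Zfac x.ψ s * Nchar D (psiBarFn x) (1 - s)‖ ≤
      max C₁ 0 * (E + Real.exp (-(min c₁ c₂) * ell D ^ 10)) :=
    calc _ ≤ C₁ * Real.exp (-c₁ * ell D ^ 10) := e1
      _ ≤ max C₁ 0 * Real.exp (-c₁ * ell D ^ 10) :=
          mul_le_mul_of_nonneg_right (le_max_left _ _) (Real.exp_pos _).le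
      _ ≤ max C₁ 0 * (E + Real.exp (-(min c₁ c₂) * ell D ^ 10)) :=
          mul_le_mul_of_nonneg_left (by linarith) (le_max_right _ _)
  have i2 : ‖I2‖ ≤ max C₂ 0 * (E + Real.exp (-(min c₁ c₂) * ell D ^ 10)) :=
    calc ‖I2‖ ≤ C₂ * (E + Real.exp (-c₂ * ell D ^ 10)) := e2
      _ ≤ max C₂ 0 * (E + Real.exp (-c₂ * ell D ^ 10)) :=
          mul_le_mul_of_nonneg_right (le_max_left _ _) (add_nonneg hE0 (Real.exp_pos _).le)
      _ ≤ max C₂ 0 * (E + Real.exp (-(min c₁ c₂) * ell D ^ 10)) :=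
          mul_le_mul_of_nonneg_left (by linarith) (le_max_right _ _)
  calc _ ≤ ‖Iprime x s + GammaFactor.Zfac x.ψ s * Nchar D (psiBarFn x) (1 - s)‖ + ‖I2‖ :=
        norm_add_le _ _
    _ ≤ (max C₁ 0 + max C₂ 0) * (E + Real.exp (-(min c₁ c₂) * ell D ^ 10)) := by
        rw [add_mul]; exact add_le_add i1 i2

end Literature.NumberTheory.LFunctions.Zhang2022.Section6Statements
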